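/-
Copyright: the b2b-balaban T⁴-continuum CRUX team, row NE7b leaf lineage `t4-ne7b-formalise-leaf-06` (gen 155). Project licence.
-/
import Mathlib.Analysis.Calculus.FDeriv.Mul
import Mathlib.Analysis.Calculus.FDeriv.Comp
import Mathlib.Analysis.Normed.Operator.Bilinear

/-!
# THE RESCALING BETWEEN TWO HARD STEPS: the chart `σ` and the next action `V⁺` read through the homothety `v ↦ t • v`
# (`t ≠ 0`) keep ALL the inductive step's letters with the radius `ρ ↦ ρ∕|t|`, the first-order constants `× |t|`, the
# second-order ones `× t²`, the Hessian-Lipschitz one `× |t|³`, the slice property for the rescaled blocking `t⁻¹ • D`, and FULL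
# criticality at the rescaled centre `t⁻¹ • w₀` — the bookkeeping that restores the radius between two steps of the tower
# (row NE7b, node U5c; Mathlib only; [folklore] chain rule with a homothety)

Cell `pub-balaban`, sub-cell `t4`, spine estimate NE7b (`T4WeightBudget.RelWeightBound`; the cell's OWN estimate — NOT PRINTED in
[Bałaban 1983–89], NOT PROVED).  Crux-route work under `Spine/NE7b/` by a row leaf (`t4-ne7b-formalise-leaf-06` gen 155) in the
hard-step cell under FREEZE (0)'s crux-prover clause; NOTHING of Bałaban's is named as a Lean object, valued or asserted; no
`T4Continuum/Support` leaf typed; no `def`; zero `sorry`.  Imports: Mathlib only — independent of the hub's olean frontier; the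
producer `…HardStepInductiveStep.inductiveStep` (HSIS, this lineage) is met BY SHAPE (its output letters (a)–(d) are this
file's hypotheses verbatim, with `U := V ∘ σ`, `S := closedBall δ₀ r`, `U″ w := (V″(σ w)).bilinearComp (σ′ w) (σ′ w)`), not
imported — so this file does not wait for HSIS's olean.

WHY.  HSIS gives ONE inductive step of the hard-step chart tower: from the scale-`k` letters on `closedBall δ₀ r` it returns the chart
`σ` and the next action `V⁺ = V ∘ σ` with their letters on `ball (Dδ₀) ρ`, `ρ = (N⁻¹ − c)·r < r`.  Iterated as is, the radii shrink
geometrically; print restores the radius between steps by a RESCALING of the coarse field (the `L`-blocking's normalisation), i.e. by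
reading `σ` and `V⁺` through a homothety `v ↦ t • v`.  HSIS lists this under NOT HERE («the choice of `r⁺` (rescaling)»).  THIS FILE is
that bookkeeping and nothing else: every letter HSIS outputs is transported through the homothety with an EXPLICIT power of `|t|`,
the radius becoming `ρ∕|t|` (so `|t| = L^{−α} < 1` enlarges it), in the SHAPE HSIS consumes at the next scale.

WHAT IS PROVED ([folklore]; `F`, `E` real normed spaces, `σ : F → E`, `U : F → ℝ`, `t : ℝ`; the rescaled maps are the λ-terms
`fun v ↦ σ (t • v)` and `fun v ↦ U (t • v)` — no `def`):
* §1 SCALAR ALGEBRA: `comp_smul_id` (`S ∘L (t • id) = t • S`), `bilinearComp_smul_id` (`Q[t•·, t•·] = t² • Q`), `norm_smul_sub_smul`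
  (`‖t • v − t • v′‖ = |t|·‖v − v′‖`), `norm_smul_hessian_le` (`‖c • X‖ ≤ |c|‖X‖` on `F →L F →L ℝ`, through the values).
* §2 THE CHAIN RULE WITH A HOMOTHETY: `hasFDerivAt_comp_smul` (`HasFDerivAt σ σ′ (t • v) ⟹ HasFDerivAt (σ ∘ (t•)) (t • σ′) v`),
  `differentiableAt_comp_smul`, `fderiv_comp_smul` (`fderiv (σ ∘ (t•)) v = t • fderiv σ (t • v)`).
* §3 BALLS: `smul_mem_ball` (`t ≠ 0`, `v ∈ ball (t⁻¹ • w₀) (ρ∕|t|) ⟹ t • v ∈ ball w₀ ρ`).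
* §4 THE END **`rescaled_letters`** — HSIS's output letters for `(σ, U)` on `ball w₀ ρ` (range in a set `S`, differentiability, the
  slice property `D(σ′k) = k`, `‖σ′‖ ≤ K₁`, `‖σ w − σ w′‖ ≤ K₁‖w − w′‖`, `‖σ′(w) − σ′(w′)‖ ≤ Λ₁‖w − w′‖`; `‖DU‖ ≤ G₁`, `DU` Lipschitz
  `Λ₂`; `HasFDerivAt (fderiv U) (U″ w) w`, `‖D²U‖ ≤ H`, `D²U` Lipschitz `Λ₃`; `DU(w₀) = 0`) ⟹ THE SAME LETTERS for
  `(σ ∘ (t•), U ∘ (t•))` on `ball (t⁻¹ • w₀) (ρ∕|t|)` with constants `|t|K₁`, `|t|K₁`, `t²Λ₁`; `|t|G₁`, `t²Λ₂`; Hessian `t² • U″(t • v)`,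
  `t²H`, `|t|³Λ₃`; the slice property for `t⁻¹ • D`; criticality `D(U ∘ (t•))(t⁻¹ • w₀) = 0`; centre `σ (t • t⁻¹ • w₀) = σ w₀`.
* §5 toy (kernel): `F = ℝ`, `t = 2`: the ball letter at `w₀ = 1`.

NOT HERE (honest): WHICH `t` is Bałaban's (the normalisation `L^{−α}` of the blocked field, (A3) ∕ (A1c), NC-NE7b-α UNRULED) and that
the rescaled radius `ρ∕|t|` dominates the previous `r` (the tower's choice of `r⁺`, a NUMERICAL condition on `N, c, L` — the step's
displayed price); the next margin `c⁺ < (N⁺)⁻¹` (TFC ∕ HSTL supply `c⁺`'s form); the blocking operator's own rescaling beyond the scalar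
`t⁻¹ • D` (a composition with a lattice isometry is a further `comp` — not needed by HSIS's letters); anything of Bałaban's.  BY-NAME
EFFECT ON THE WALL: NONE.  NE7b NOT PRINTED ∕ NOT PROVED; spine PROVED 0∕9; rung (B)+1 on a FINITE torus — NOT infinite volume, NOT
the mass gap, NOT Clay.  HONEST DEPENDENCY: continuum YM on T⁴ ⇐ BetaPertH ∧ nine spine estimates (0∕9 proved); BetaPertH ⇐ (D1) ∧
(D4) ∧ CAP+tail; G-an2-4 gates asym, D1 and NE2∕3∕4.
-/

set_option autoImplicit false

noncomputable section

namespace Summit.QuantumFields.BalabanUV.T4Continuum.NE7b.HardStepRescalingLetters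

open Set Metric Filter Topology

variable {E F : Type*} [NormedAddCommGroup E] [NormedSpace ℝ E] [NormedAddCommGroup F] [NormedSpace ℝ F]

/-! ## §1. Scalar algebra of the homothety -/

/-- `S ∘L (t • id) = t • S`. [folklore] -/
theorem comp_smul_id (S : F →L[ℝ] E) (t : ℝ) : S.comp (t • ContinuousLinearMap.id ℝ F) = t • S := by
  ext v
  simp only [ContinuousLinearMap.coe_comp, Function.comp_apply, smul_apply, ContinuousLinearMap.id_apply, map_smul]

/-- `Q[t • ·, t • ·] = t² • Q` for a continuous bilinear form `Q`. [folklore] -/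
theorem bilinearComp_smul_id (Q : F →L[ℝ] F →L[ℝ] ℝ) (t : ℝ) :
    Q.bilinearComp (t • ContinuousLinearMap.id ℝ F) (t • ContinuousLinearMap.id ℝ F) = (t ^ 2) • Q := by
  ext x y
  simp only [ContinuousLinearMap.bilinearComp_apply, smul_apply, ContinuousLinearMap.id_apply, map_smul, smul_eq_mul]
  ring

/-- `‖t • v − t • v′‖ = |t|·‖v − v′‖`. [folklore] -/
theorem norm_smul_sub_smul (t : ℝ) (v v' : F) : ‖t • v - t • v'‖ = |t| * ‖v - v'‖ := by
  rw [← smul_sub, norm_smul, Real.norm_eq_abs]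

/-- `‖c • X‖ ≤ |c|·‖X‖` on the Hessian space `F →L F →L ℝ`, by `opNorm_le_bound` through the values `X k : F →L ℝ`. [folklore] -/
theorem norm_smul_hessian_le (c : ℝ) (X : F →L[ℝ] F →L[ℝ] ℝ) : ‖c • X‖ ≤ |c| * ‖X‖ := by
  refine ContinuousLinearMap.opNorm_le_bound _ (mul_nonneg (abs_nonneg c) (norm_nonneg X)) fun k => ?_
  rw [smul_apply, norm_smul, Real.norm_eq_abs, mul_assoc]
  exact mul_le_mul_of_nonneg_left (X.le_opNorm k) (abs_nonneg c)

/-! ## §2. The chain rule with a homothety -/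

/-- `HasFDerivAt σ σ′ (t • v) ⟹ HasFDerivAt (fun v ↦ σ (t • v)) (t • σ′) v`. [folklore] -/
theorem hasFDerivAt_comp_smul {σ : F → E} {σ' : F →L[ℝ] E} {t : ℝ} {v : F} (h : HasFDerivAt σ σ' (t • v)) :
    HasFDerivAt (fun v : F => σ (t • v)) (t • σ') v := by
  have h1 : HasFDerivAt (fun v : F => t • v) (t • ContinuousLinearMap.id ℝ F) v := (hasFDerivAt_id v).const_smul t
  have h2 := h.comp v h1
  rw [comp_smul_id] at h2
  exact h2

/-- Differentiability of `σ ∘ (t•)` at `v` from that of `σ` at `t • v`. [folklore] -/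
theorem differentiableAt_comp_smul {σ : F → E} {t : ℝ} {v : F} (h : DifferentiableAt ℝ σ (t • v)) :
    DifferentiableAt ℝ (fun v : F => σ (t • v)) v :=
  (hasFDerivAt_comp_smul h.hasFDerivAt).differentiableAt

/-- `fderiv (σ ∘ (t•)) v = t • fderiv σ (t • v)`. [folklore] -/
theorem fderiv_comp_smul {σ : F → E} {t : ℝ} {v : F} (h : DifferentiableAt ℝ σ (t • v)) :
    fderiv ℝ (fun v : F => σ (t • v)) v = t • fderiv ℝ σ (t • v) :=
  (hasFDerivAt_comp_smul h.hasFDerivAt).fderiv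

/-! ## §3. Balls under the homothety -/

/-- `t ≠ 0`, `v ∈ ball (t⁻¹ • w₀) (ρ∕|t|) ⟹ t • v ∈ ball w₀ ρ` — the radius is divided by `|t|` (enlarged when `|t| < 1`). [folklore] -/
theorem smul_mem_ball {t : ℝ} (ht : t ≠ 0) {w₀ v : F} {ρ : ℝ} (hv : v ∈ ball (t⁻¹ • w₀) (ρ / |t|)) :
    t • v ∈ ball w₀ ρ := by
  have ht' : 0 < |t| := abs_pos.mpr ht
  rw [mem_ball, dist_eq_norm] at hv ⊢
  have e : t • v - w₀ = t • v - t • (t⁻¹ • w₀) := by rw [smul_inv_smul₀ ht]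
  rw [e, norm_smul_sub_smul]
  calc |t| * ‖v - t⁻¹ • w₀‖ < |t| * (ρ / |t|) := mul_lt_mul_of_pos_left hv ht'
    _ = ρ := mul_div_cancel₀ ρ ht'.ne'

/-! ## §4. The END: every letter of the inductive step, rescaled -/

/-- **THE RESCALED LETTERS.**  Let `σ : F → E` (the chart) and `U : F → ℝ` (the next action `V ∘ σ`) carry, on `ball w₀ ρ`, the
output letters of `…HardStepInductiveStep.inductiveStep`: range in a set `S`, differentiability, the slice property `D(σ′(w)k) = k`,
`‖σ′‖ ≤ K₁`, `‖σ w − σ w′‖ ≤ K₁‖w − w′‖`, `‖σ′(w) − σ′(w′)‖ ≤ Λ₁‖w − w′‖`; `‖DU‖ ≤ G₁`, `‖DU(w) − DU(w′)‖ ≤ Λ₂‖w − w′‖`;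
`HasFDerivAt (fderiv U) (U″ w) w`, `‖D²U(w)‖ ≤ H`, `‖D²U(w) − D²U(w′)‖ ≤ Λ₃‖w − w′‖`; `DU(w₀) = 0`.  Then for `t ≠ 0` the rescaled
pair `(fun v ↦ σ (t • v), fun v ↦ U (t • v))` carries THE SAME LETTERS on `ball (t⁻¹ • w₀) (ρ∕|t|)` with constants `|t|K₁` (twice),
`t²Λ₁`; `|t|G₁`, `t²Λ₂`; Hessian `t² • U″(t • v)` with `t²H`, `|t|³Λ₃`; the slice property for the rescaled blocking `t⁻¹ • D`;
FULL criticality at `t⁻¹ • w₀`; and the centre is unchanged, `σ (t • t⁻¹ • w₀) = σ w₀` — the shape `inductiveStep` consumes at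
the next scale. [folklore] -/
theorem rescaled_letters {σ : F → E} {U : F → ℝ} {U'' : F → F →L[ℝ] F →L[ℝ] ℝ} (D : E →L[ℝ] F) {S : Set E} {w₀ : F}
    {ρ K₁ Λ₁ G₁ Λ₂ H Λ₃ t : ℝ} (ht : t ≠ 0) (hρ : 0 < ρ)
    (hσ : ∀ w ∈ ball w₀ ρ, σ w ∈ S ∧ DifferentiableAt ℝ σ w ∧ (∀ k, D (fderiv ℝ σ w k) = k) ∧ ‖fderiv ℝ σ w‖ ≤ K₁)
    (hσ₂ : ∀ w ∈ ball w₀ ρ, ∀ w' ∈ ball w₀ ρ,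
      ‖σ w - σ w'‖ ≤ K₁ * ‖w - w'‖ ∧ ‖fderiv ℝ σ w - fderiv ℝ σ w'‖ ≤ Λ₁ * ‖w - w'‖)
    (hU : ∀ w ∈ ball w₀ ρ, DifferentiableAt ℝ U w ∧ ‖fderiv ℝ U w‖ ≤ G₁)
    (hU₂ : ∀ w ∈ ball w₀ ρ, ∀ w' ∈ ball w₀ ρ, ‖fderiv ℝ U w - fderiv ℝ U w'‖ ≤ Λ₂ * ‖w - w'‖)
    (hU'' : ∀ w ∈ ball w₀ ρ, HasFDerivAt (fderiv ℝ U) (U'' w) w ∧ ‖fderiv ℝ (fderiv ℝ U) w‖ ≤ H)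
    (hU''₂ : ∀ w ∈ ball w₀ ρ, ∀ w' ∈ ball w₀ ρ,
      ‖fderiv ℝ (fderiv ℝ U) w - fderiv ℝ (fderiv ℝ U) w'‖ ≤ Λ₃ * ‖w - w'‖)
    (hcrit : fderiv ℝ U w₀ = 0) :
    -- centre
    (fun v : F => σ (t • v)) (t⁻¹ • w₀) = σ w₀ ∧
    -- (a) the chart's pointwise letters
    (∀ v ∈ ball (t⁻¹ • w₀) (ρ / |t|), (fun v : F => σ (t • v)) v ∈ S ∧
      DifferentiableAt ℝ (fun v : F => σ (t • v)) v ∧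
      (∀ k, (t⁻¹ • D) (fderiv ℝ (fun v : F => σ (t • v)) v k) = k) ∧
      ‖fderiv ℝ (fun v : F => σ (t • v)) v‖ ≤ |t| * K₁) ∧
    -- (a′) the chart's two-point letters
    (∀ v ∈ ball (t⁻¹ • w₀) (ρ / |t|), ∀ v' ∈ ball (t⁻¹ • w₀) (ρ / |t|),
      ‖(fun v : F => σ (t • v)) v - (fun v : F => σ (t • v)) v'‖ ≤ |t| * K₁ * ‖v - v'‖ ∧
      ‖fderiv ℝ (fun v : F => σ (t • v)) v - fderiv ℝ (fun v : F => σ (t • v)) v'‖ ≤ t ^ 2 * Λ₁ * ‖v - v'‖) ∧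
    -- (b) the action's first-order letters
    (∀ v ∈ ball (t⁻¹ • w₀) (ρ / |t|), DifferentiableAt ℝ (fun v : F => U (t • v)) v ∧
      ‖fderiv ℝ (fun v : F => U (t • v)) v‖ ≤ |t| * G₁) ∧
    (∀ v ∈ ball (t⁻¹ • w₀) (ρ / |t|), ∀ v' ∈ ball (t⁻¹ • w₀) (ρ / |t|),
      ‖fderiv ℝ (fun v : F => U (t • v)) v - fderiv ℝ (fun v : F => U (t • v)) v'‖ ≤ t ^ 2 * Λ₂ * ‖v - v'‖) ∧
    -- (c) the action's Hessian letters
    (∀ v ∈ ball (t⁻¹ • w₀) (ρ / |t|),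
      HasFDerivAt (fderiv ℝ (fun v : F => U (t • v))) ((t ^ 2) • U'' (t • v)) v ∧
      ‖fderiv ℝ (fderiv ℝ (fun v : F => U (t • v))) v‖ ≤ t ^ 2 * H) ∧
    (∀ v ∈ ball (t⁻¹ • w₀) (ρ / |t|), ∀ v' ∈ ball (t⁻¹ • w₀) (ρ / |t|),
      ‖fderiv ℝ (fderiv ℝ (fun v : F => U (t • v))) v - fderiv ℝ (fderiv ℝ (fun v : F => U (t • v))) v'‖ ≤
        |t| ^ 3 * Λ₃ * ‖v - v'‖) ∧
    -- (d) FULL criticality at the rescaled centre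
    fderiv ℝ (fun v : F => U (t • v)) (t⁻¹ • w₀) = 0 := by
  have ht' : 0 < |t| := abs_pos.mpr ht
  have hsq : t ^ 2 = |t| * |t| := by rw [← sq_abs, sq]
  -- transport of points
  have mem : ∀ v ∈ ball (t⁻¹ • w₀) (ρ / |t|), t • v ∈ ball w₀ ρ := fun v hv => smul_mem_ball ht hv
  -- the first derivatives, pointwise
  have dσ : ∀ v ∈ ball (t⁻¹ • w₀) (ρ / |t|), fderiv ℝ (fun v : F => σ (t • v)) v = t • fderiv ℝ σ (t • v) :=
    fun v hv => fderiv_comp_smul (hσ _ (mem v hv)).2.1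
  have dU : ∀ v ∈ ball (t⁻¹ • w₀) (ρ / |t|), fderiv ℝ (fun v : F => U (t • v)) v = t • fderiv ℝ U (t • v) :=
    fun v hv => fderiv_comp_smul (hU _ (mem v hv)).1
  -- the second derivative of the rescaled action
  have d2U : ∀ v ∈ ball (t⁻¹ • w₀) (ρ / |t|),
      HasFDerivAt (fderiv ℝ (fun v : F => U (t • v))) ((t ^ 2) • U'' (t • v)) v := by
    intro v hv
    have h1 : HasFDerivAt (fun v : F => fderiv ℝ U (t • v)) (t • U'' (t • v)) v :=
      hasFDerivAt_comp_smul (hU'' _ (mem v hv)).1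
    have h2 : HasFDerivAt (fun v : F => t • fderiv ℝ U (t • v)) (t • (t • U'' (t • v))) v := h1.const_smul t
    rw [smul_smul, ← sq] at h2
    refine h2.congr_of_eventuallyEq ?_
    exact Filter.eventuallyEq_of_mem (isOpen_ball.mem_nhds hv) fun v' hv' => dU v' hv'
  have d2U' : ∀ v ∈ ball (t⁻¹ • w₀) (ρ / |t|),
      fderiv ℝ (fderiv ℝ (fun v : F => U (t • v))) v = (t ^ 2) • fderiv ℝ (fderiv ℝ U) (t • v) := by
    intro v hv
    rw [(d2U v hv).fderiv, (hU'' _ (mem v hv)).1.fderiv]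
  refine ⟨?_, ?_, ?_, ?_, ?_, ?_, ?_, ?_⟩
  -- centre
  · show σ (t • t⁻¹ • w₀) = σ w₀
    rw [smul_inv_smul₀ ht]
  -- (a)
  · intro v hv
    refine ⟨(hσ _ (mem v hv)).1, differentiableAt_comp_smul (hσ _ (mem v hv)).2.1, fun k => ?_, ?_⟩
    · rw [dσ v hv, smul_apply, smul_apply, map_smul,
        (hσ _ (mem v hv)).2.2.1 k, inv_smul_smul₀ ht]
    · rw [dσ v hv, norm_smul, Real.norm_eq_abs]
      exact mul_le_mul_of_nonneg_left (hσ _ (mem v hv)).2.2.2 ht'.le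
  -- (a′)
  · intro v hv v' hv'
    refine ⟨?_, ?_⟩
    · calc ‖σ (t • v) - σ (t • v')‖ ≤ K₁ * ‖t • v - t • v'‖ := (hσ₂ _ (mem v hv) _ (mem v' hv')).1
        _ = |t| * K₁ * ‖v - v'‖ := by rw [norm_smul_sub_smul]; ring
    · rw [dσ v hv, dσ v' hv', ← smul_sub, norm_smul, Real.norm_eq_abs]
      calc |t| * ‖fderiv ℝ σ (t • v) - fderiv ℝ σ (t • v')‖ ≤ |t| * (Λ₁ * ‖t • v - t • v'‖) :=
            mul_le_mul_of_nonneg_left (hσ₂ _ (mem v hv) _ (mem v' hv')).2 ht'.le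
        _ = t ^ 2 * Λ₁ * ‖v - v'‖ := by rw [norm_smul_sub_smul, hsq]; ring
  -- (b)
  · intro v hv
    refine ⟨differentiableAt_comp_smul (hU _ (mem v hv)).1, ?_⟩
    rw [dU v hv, norm_smul, Real.norm_eq_abs]
    exact mul_le_mul_of_nonneg_left (hU _ (mem v hv)).2 ht'.le
  · intro v hv v' hv'
    rw [dU v hv, dU v' hv', ← smul_sub, norm_smul, Real.norm_eq_abs]
    calc |t| * ‖fderiv ℝ U (t • v) - fderiv ℝ U (t • v')‖ ≤ |t| * (Λ₂ * ‖t • v - t • v'‖) :=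
          mul_le_mul_of_nonneg_left (hU₂ _ (mem v hv) _ (mem v' hv')) ht'.le
      _ = t ^ 2 * Λ₂ * ‖v - v'‖ := by rw [norm_smul_sub_smul, hsq]; ring
  -- (c)
  · intro v hv
    refine ⟨d2U v hv, ?_⟩
    rw [d2U' v hv]
    refine (norm_smul_hessian_le _ _).trans ?_
    rw [abs_pow, sq_abs]
    exact mul_le_mul_of_nonneg_left (hU'' _ (mem v hv)).2 (sq_nonneg t)
  · intro v hv v' hv'
    have e : (t ^ 2) • fderiv ℝ (fderiv ℝ U) (t • v) - (t ^ 2) • fderiv ℝ (fderiv ℝ U) (t • v') =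
        (t ^ 2) • (fderiv ℝ (fderiv ℝ U) (t • v) - fderiv ℝ (fderiv ℝ U) (t • v')) := by rw [smul_sub]
    rw [d2U' v hv, d2U' v' hv', e]
    refine (norm_smul_hessian_le _ _).trans ?_
    rw [abs_pow, sq_abs]
    calc t ^ 2 * ‖fderiv ℝ (fderiv ℝ U) (t • v) - fderiv ℝ (fderiv ℝ U) (t • v')‖
        ≤ t ^ 2 * (Λ₃ * ‖t • v - t • v'‖) :=
          mul_le_mul_of_nonneg_left (hU''₂ _ (mem v hv) _ (mem v' hv')) (sq_nonneg t)
      _ = |t| ^ 3 * Λ₃ * ‖v - v'‖ := by rw [norm_smul_sub_smul, hsq]; ring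
  -- (d)
  · have h0 : t⁻¹ • w₀ ∈ ball (t⁻¹ • w₀) (ρ / |t|) := mem_ball_self (div_pos hρ ht')
    rw [dU _ h0, smul_inv_smul₀ ht, hcrit, smul_zero]

/-! ## §5. Toy -/

/-- Toy (kernel): `F = ℝ`, `t = 2`, `w₀ = 1`: a point of `ball (2⁻¹ • 1) (ρ∕|2|)` is sent by `v ↦ 2 • v` into `ball 1 ρ`. -/
example (ρ v : ℝ) (hv : v ∈ ball ((2 : ℝ)⁻¹ • (1 : ℝ)) (ρ / |(2 : ℝ)|)) : (2 : ℝ) • v ∈ ball (1 : ℝ) ρ :=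
  smul_mem_ball two_ne_zero hv

end Summit.QuantumFields.BalabanUV.T4Continuum.NE7b.HardStepRescalingLetters
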